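import Summits.NavierStokesRegularity.NavierStokesRegularity.Theorems.SqueezeCycleExtremalBiaxialitySubcriticalPayerTomographyKernels
import HarnessLib

/-!
# Route `SqueezeCycle`, crux `ExtremalBiaxialitySubcritical` — the far-shell bound for the
# polar-quadrupole tomography of the pressure Hessian (line `oseen-shell-polar-tomography`,
# stub `stub_payerTomography`), II

Helper file for item `stmt-NavierStokesRegularity-11609`
(`Summit.NavierStokesRegularity.NavierStokesRegularity.Theses.SqueezeCycle.ExtremalBiaxialitySubcritical`).

Main result `abs_setIntegral_ball_hess_newtonFar_mul_le`: there is an absolute constant `c_J`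
such that for every divergence-free `u ∈ C²(ℝ³; ℝ³)` with `|u| ≤ M`, `‖∇u‖ ≤ M₁`, every `R > 0`,
`x` and unit `e`,

  `|∫_{|z| < R} D²Γ∞^{R/2,R}(z)(e,e) · div((u·∇)u)(x − z) dz| ≤ c_J (M M₁ / R + M² / R²)`,

where `Γ∞^{R/2,R} = newtonFar (R/2) R` is the smooth far part of the Newtonian kernel (vanishing
on `|z| ≤ R/2`). This is the "far shell + sphere boundary" error of the truncated quadrupole
transform: `div((u·∇)u) = ∂ᵢ∂ⱼ(uᵢuⱼ)` is a double divergence of the bounded tensor `u ⊗ u`, and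
the sharp truncation at `|z| = R` costs one boundary layer. Boundary-free proof: approximate
`1_{|z|<R}` by the radial cutoffs `θ_{s,R}` (`s ↑ R`), integrate by parts once onto `(u·∇)u`
(`∫ Φ div W = ∫ DΦ(W)`), then use the trilinear identity `∫⟪(u·∇)u, V⟫ = −∫⟪u, DV(u)⟫`
(`div u = 0`) for the part of `DΦ` carried by the kernel; the cutoff gradients contribute
`∫‖Dθ_{s,R}‖ ≤ 6|B̄₁|R²` (previous file), the kernel derivatives `‖DᵏΓ∞^{R/2,R}‖ ≲ R^{-1-k}`
(scaling), and dominated convergence `s → R⁻` returns to the sharp ball.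

Sources: calculus folklore (Leray 1934 §6 (1.11) for the whole-space integrations by parts).
-/

noncomputable section

open MeasureTheory Set Filter Metric Topology InnerProductSpace Function Real
open scoped RealInnerProductSpace Laplacian ContDiff ENNReal NNReal

namespace Summit.NavierStokesRegularity.NavierStokesRegularity.Theorems

open Literature.Analysis Literature.Analysis.FluidPDE

set_option linter.dupNamespace false

-- nested operator types `ℝ³ →L[ℝ] ℝ³ →L[ℝ] ℝ³ →L[ℝ] ℝ³ →L[ℝ] ℝ`
set_option maxSynthPendingDepth 4

/-! ## Two integrations by parts -/

section IBP

set_option maxHeartbeats 400000 in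
/-- **`∫ Φ(z) div((u·∇)u)(x − z) dz = ∫ DΦ(x − y)((u·∇)u(y)) dy`** for `Φ ∈ C¹_c(ℝ³)` and
`u ∈ C²` (one integration by parts on the whole space, `∫ θ div W = −∫ ⟪W, ∇θ⟫` with
`θ = Φ(x − ·)`). [folklore] -/
theorem integral_mul_divergence_convect_comp_sub {Φ : EuclideanSpace ℝ (Fin 3) → ℝ}
    (hΦ : ContDiff ℝ 1 Φ) (hΦc : HasCompactSupport Φ)
    {u : EuclideanSpace ℝ (Fin 3) → EuclideanSpace ℝ (Fin 3)} (hu : ContDiff ℝ 2 u)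
    (x : EuclideanSpace ℝ (Fin 3)) :
    ∫ z, Φ z * VectorCalculus.divergence (convect u u) (x - z) =
      ∫ y, fderiv ℝ Φ (x - y) (convect u u y) := by
  have hW : ContDiff ℝ 1 (convect u u) := contDiff_convect_self (by exact_mod_cast hu)
  set θ : EuclideanSpace ℝ (Fin 3) → ℝ := fun y => Φ (x - y) with hθ
  have hθs : ContDiff ℝ 1 θ := hΦ.comp (contDiff_const.sub contDiff_id)
  have hθc : HasCompactSupport θ := hΦc.comp_homeomorph (Homeomorph.subLeft x)
  have h := integral_mul_divergence_add_eq_zero_left hθs hW hθc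
  have hcv : ∫ z, Φ z * VectorCalculus.divergence (convect u u) (x - z) =
      ∫ y, θ y * VectorCalculus.divergence (convect u u) y := by
    rw [← integral_sub_left_eq_self
      (fun y => θ y * VectorCalculus.divergence (convect u u) y) volume x]
    refine integral_congr_ae (Eventually.of_forall fun z => ?_)
    simp only [hθ, sub_sub_cancel]
  have hgrad : ∀ y, ⟪convect u u y, gradient θ y⟫ = -fderiv ℝ Φ (x - y) (convect u u y) := by
    intro y
    rw [inner_gradient_eq_fderiv_apply, hθ, fderiv_comp_const_sub]
    rfl
  have h2 : ∫ y, ⟪convect u u y, gradient θ y⟫ = -∫ y, fderiv ℝ Φ (x - y) (convect u u y) := by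
    rw [← integral_neg]
    exact integral_congr_ae (Eventually.of_forall hgrad)
  rw [hcv]
  linarith

/-- **Trilinear identity for a divergence-free field**: `∫ ⟪(u·∇)u, V⟫ = −∫ ⟪u, DV(u)⟫` for
`u ∈ C¹` with `div u = 0` and `V ∈ C¹_c` (Leray 1934, §6 (1.11)). [folklore] -/
theorem integral_inner_convect_self_eq_neg
    {u V : EuclideanSpace ℝ (Fin 3) → EuclideanSpace ℝ (Fin 3)} (hu : ContDiff ℝ 1 u)
    (hdiv : VectorCalculus.IsDivFree u) (hV : ContDiff ℝ 1 V) (hVc : HasCompactSupport V) :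
    ∫ y, ⟪convect u u y, V y⟫ = -∫ y, ⟪u y, fderiv ℝ V y (u y)⟫ := by
  have h := integral_inner_convect_add_eq_zero hu hu hV hVc
  have h0 : ∫ y, VectorCalculus.divergence u y * ⟪u y, V y⟫ = 0 := by
    refine integral_eq_zero_of_ae (Eventually.of_forall fun y => ?_)
    simp only [hdiv y, zero_mul, Pi.zero_apply]
  simp only [convect_apply] at h ⊢
  linarith

set_option maxHeartbeats 400000 in
/-- **`|∫ ⟪(u·∇)u, V⟫| ≤ M² ∫ ‖DV‖`** for `|u| ≤ M` (div-free `u ∈ C¹`, `V ∈ C¹_c`). [folklore] -/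
theorem abs_integral_inner_convect_self_le
    {u V : EuclideanSpace ℝ (Fin 3) → EuclideanSpace ℝ (Fin 3)} (hu : ContDiff ℝ 1 u)
    (hdiv : VectorCalculus.IsDivFree u) (hV : ContDiff ℝ 1 V) (hVc : HasCompactSupport V)
    {M : ℝ} (hM : ∀ y, ‖u y‖ ≤ M) :
    |∫ y, ⟪convect u u y, V y⟫| ≤ M ^ 2 * ∫ y, ‖fderiv ℝ V y‖ := by
  have hM0 : 0 ≤ M := (norm_nonneg _).trans (hM 0)
  rw [integral_inner_convect_self_eq_neg hu hdiv hV hVc, abs_neg]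
  have hint : Integrable fun y => ‖fderiv ℝ V y‖ :=
    ((hV.continuous_fderiv one_ne_zero).norm).integrable_of_hasCompactSupport
      (hVc.fderiv (𝕜 := ℝ)).norm
  calc |∫ y, ⟪u y, fderiv ℝ V y (u y)⟫| ≤ ∫ y, |⟪u y, fderiv ℝ V y (u y)⟫| :=
        abs_integral_le_integral_abs
    _ ≤ ∫ y, M ^ 2 * ‖fderiv ℝ V y‖ := by
        refine integral_mono_of_nonneg (Eventually.of_forall fun y => abs_nonneg _)
          (hint.const_mul _) (Eventually.of_forall fun y => ?_)
        calc |⟪u y, fderiv ℝ V y (u y)⟫| ≤ ‖u y‖ * ‖fderiv ℝ V y (u y)‖ :=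
              abs_real_inner_le_norm _ _
          _ ≤ M * (‖fderiv ℝ V y‖ * M) :=
              mul_le_mul (hM y) ((ContinuousLinearMap.le_opNorm _ _).trans
                (mul_le_mul_of_nonneg_left (hM y) (norm_nonneg _))) (norm_nonneg _) hM0
          _ = M ^ 2 * ‖fderiv ℝ V y‖ := by ring
    _ = M ^ 2 * ∫ y, ‖fderiv ℝ V y‖ := integral_const_mul _ _

end IBP

/-! ## The kernel `K = D²F(·)(e,e)` and its derivatives -/

section Kernel

set_option maxHeartbeats 800000 in
/-- **Chain rule through the evaluation maps**: for `F ∈ C⁴(ℝ³)` and a unit vector `e`, the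
scalar kernel `K(z) = D²F(z)(e,e)` is `C²` with `‖DK(z)‖ ≤ ‖D³F(z)‖` and `‖D²K(z)‖ ≤ ‖D⁴F(z)‖`
(`K = ev_{e,e} ∘ D²F`, `‖ev_{e,e}‖ ≤ ‖e‖² = 1`, and Mathlib's
`ContinuousLinearMap.norm_iteratedFDeriv_comp_left`). [folklore] -/
theorem hessKernel_facts {F : EuclideanSpace ℝ (Fin 3) → ℝ} (hF : ContDiff ℝ 4 F)
    {e : EuclideanSpace ℝ (Fin 3)} (he : ‖e‖ = 1) :
    ContDiff ℝ 2 (fun z => fderiv ℝ (fderiv ℝ F) z e e) ∧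
    (∀ z, |fderiv ℝ (fderiv ℝ F) z e e| ≤ ‖fderiv ℝ (fderiv ℝ F) z‖) ∧
    (∀ z, ‖fderiv ℝ (fun z => fderiv ℝ (fderiv ℝ F) z e e) z‖ ≤
      ‖fderiv ℝ (fderiv ℝ (fderiv ℝ F)) z‖) ∧
    (∀ z, ‖fderiv ℝ (fderiv ℝ (fun z => fderiv ℝ (fderiv ℝ F) z e e)) z‖ ≤
      ‖fderiv ℝ (fderiv ℝ (fderiv ℝ (fderiv ℝ F))) z‖) := by
  have hG₂s : ContDiff ℝ 2 (fderiv ℝ (fderiv ℝ F)) :=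
    (hF.fderiv_right (m := 3) (by norm_num)).fderiv_right (m := 2) (by norm_num)
  -- `K = evalDiag e ∘ D²F`
  have hKe : (fun z => fderiv ℝ (fderiv ℝ F) z e e) = ⇑(evalDiag e) ∘ fderiv ℝ (fderiv ℝ F) := by
    funext z; rw [Function.comp_apply, evalDiag_apply]
  have hKs : ContDiff ℝ 2 (fun z => fderiv ℝ (fderiv ℝ F) z e e) := by
    rw [hKe]; exact (evalDiag e).contDiff.comp hG₂s
  have hev : ‖evalDiag e‖ ≤ 1 := by
    have := norm_evalDiag_le e; rw [he, one_pow] at this; exact this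
  -- nested derivatives versus iterated derivatives
  have hm1 : ∀ z, ‖iteratedFDeriv ℝ 1 (fderiv ℝ (fderiv ℝ F)) z‖ =
      ‖fderiv ℝ (fderiv ℝ (fderiv ℝ F)) z‖ := fun z => by
    rw [← norm_iteratedFDeriv_fderiv (𝕜 := ℝ), norm_iteratedFDeriv_zero]
  have hm2 : ∀ z, ‖iteratedFDeriv ℝ 2 (fderiv ℝ (fderiv ℝ F)) z‖ =
      ‖fderiv ℝ (fderiv ℝ (fderiv ℝ (fderiv ℝ F))) z‖ := fun z => by
    rw [← norm_iteratedFDeriv_fderiv (𝕜 := ℝ), ← norm_iteratedFDeriv_fderiv (𝕜 := ℝ),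
      norm_iteratedFDeriv_zero]
  refine ⟨hKs, fun z => ?_, fun z => ?_, fun z => ?_⟩
  · rw [← Real.norm_eq_abs]
    calc ‖fderiv ℝ (fderiv ℝ F) z e e‖ ≤ ‖fderiv ℝ (fderiv ℝ F) z e‖ * ‖e‖ :=
          ContinuousLinearMap.le_opNorm _ _
      _ ≤ ‖fderiv ℝ (fderiv ℝ F) z‖ * ‖e‖ * ‖e‖ :=
          mul_le_mul_of_nonneg_right (ContinuousLinearMap.le_opNorm _ _) (norm_nonneg _)
      _ = ‖fderiv ℝ (fderiv ℝ F) z‖ := by rw [he, mul_one, mul_one]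
  · rw [← norm_iteratedFDeriv_zero (𝕜 := ℝ) (f := fderiv ℝ (fun z => fderiv ℝ (fderiv ℝ F) z e e)),
      norm_iteratedFDeriv_fderiv, hKe, ← hm1 z]
    have h := ContinuousLinearMap.norm_iteratedFDeriv_comp_left (evalDiag e)
      (hG₂s.contDiffAt (x := z)) (n := 1) (by norm_num)
    exact h.trans ((mul_le_mul_of_nonneg_right hev (norm_nonneg _)).trans_eq (one_mul _))
  · rw [← norm_iteratedFDeriv_zero (𝕜 := ℝ)
        (f := fderiv ℝ (fderiv ℝ fun z => fderiv ℝ (fderiv ℝ F) z e e)),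
      norm_iteratedFDeriv_fderiv, norm_iteratedFDeriv_fderiv, hKe, ← hm2 z]
    have h := ContinuousLinearMap.norm_iteratedFDeriv_comp_left (evalDiag e)
      (hG₂s.contDiffAt (x := z)) (n := 2) (by norm_num)
    exact h.trans ((mul_le_mul_of_nonneg_right hev (norm_nonneg _)).trans_eq (one_mul _))

end Kernel

/-! ## The smoothly truncated shell integral: identity and bound -/

section Shell

set_option maxHeartbeats 800000 in
/-- **The smoothly truncated shell integral after two integrations by parts.** For `F ∈ C⁴(ℝ³)`
with `‖D²F‖ ≤ B₂`, `‖D³F‖ ≤ B₃`, `‖D⁴F‖ ≤ B₄`, the radial cutoff `θ = θ_{s,R}` (`0 < s < R`), a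
unit vector `e`, and a divergence-free `u ∈ C²` with `|u| ≤ M`, `‖∇u‖ ≤ M₁`:
`|∫ θ(z) D²F(z)(e,e) div((u·∇)u)(x − z) dz| ≤ B₂ M₁ M (3|B̄_R|/s) + M² (B₄ |B̄_R| + B₃ (3|B̄_R|/s))`
(`∫ Φ div W(x−·) = ∫ DΦ(x−y)(W y)`, `DΦ = θ DK + K Dθ`, `K = D²F(e,e)`; the `θ DK` part is
`∫⟪W, θ∇K⟫ = −∫⟪u, D(θ∇K)(u)⟫`). [folklore] -/
theorem abs_integral_cutoff_hess_mul_divergence_convect_le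
    {F : EuclideanSpace ℝ (Fin 3) → ℝ} (hF : ContDiff ℝ 4 F) {B₂ B₃ B₄ : ℝ}
    (hB₂ : ∀ z, ‖fderiv ℝ (fderiv ℝ F) z‖ ≤ B₂)
    (hB₃ : ∀ z, ‖fderiv ℝ (fderiv ℝ (fderiv ℝ F)) z‖ ≤ B₃)
    (hB₄ : ∀ z, ‖fderiv ℝ (fderiv ℝ (fderiv ℝ (fderiv ℝ F))) z‖ ≤ B₄)
    {s R : ℝ} (hs : 0 < s) (hsR : s < R) {e : EuclideanSpace ℝ (Fin 3)} (he : ‖e‖ = 1)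
    {u : EuclideanSpace ℝ (Fin 3) → EuclideanSpace ℝ (Fin 3)} (hu : ContDiff ℝ 2 u)
    (hdiv : VectorCalculus.IsDivFree u) {M M₁ : ℝ} (hM : ∀ y, ‖u y‖ ≤ M)
    (hM₁ : ∀ y, ‖fderiv ℝ u y‖ ≤ M₁) (x : EuclideanSpace ℝ (Fin 3)) :
    |∫ z, ((radialCutoff s R : EuclideanSpace ℝ (Fin 3) → ℝ) z * fderiv ℝ (fderiv ℝ F) z e e) *
        VectorCalculus.divergence (convect u u) (x - z)| ≤
      B₂ * (M₁ * M) * (3 * (volume (closedBall (0 : EuclideanSpace ℝ (Fin 3)) R)).toReal / s) +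
        M ^ 2 * (B₄ * (volume (closedBall (0 : EuclideanSpace ℝ (Fin 3)) R)).toReal +
          B₃ * (3 * (volume (closedBall (0 : EuclideanSpace ℝ (Fin 3)) R)).toReal / s)) := by
  obtain ⟨hKs, hK0, hK1, hK2⟩ := hessKernel_facts hF he
  set K : EuclideanSpace ℝ (Fin 3) → ℝ := fun z => fderiv ℝ (fderiv ℝ F) z e e with hKdef
  set ψ : EuclideanSpace ℝ (Fin 3) → ℝ := radialCutoff s R with hψdef
  set vR : ℝ := (volume (closedBall (0 : EuclideanSpace ℝ (Fin 3)) R)).toReal with hvR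
  have hM0 : 0 ≤ M := (norm_nonneg _).trans (hM 0)
  have hM₁0 : 0 ≤ M₁ := (norm_nonneg _).trans (hM₁ 0)
  have hB₂0 : 0 ≤ B₂ := (norm_nonneg _).trans (hB₂ 0)
  have hB₃0 : 0 ≤ B₃ := (norm_nonneg _).trans (hB₃ 0)
  have hB₄0 : 0 ≤ B₄ := (norm_nonneg _).trans (hB₄ 0)
  -- regularity and supports
  have hψs : ContDiff ℝ 1 ψ := radialCutoff_contDiff s R
  have hψc : HasCompactSupport ψ := hasCompactSupport_radialCutoff hs.le hsR
  have hKs1 : ContDiff ℝ 1 K := hKs.of_le one_le_two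
  have hKd : Differentiable ℝ K := hKs1.differentiable one_ne_zero
  have hψd : Differentiable ℝ ψ := hψs.differentiable one_ne_zero
  have hΦs : ContDiff ℝ 1 fun z => ψ z * K z := hψs.mul hKs1
  have hΦc : HasCompactSupport fun z => ψ z * K z := hψc.mul_right
  have hu1 : ContDiff ℝ 1 u := hu.of_le one_le_two
  have hW : ContDiff ℝ 1 (convect u u) := contDiff_convect_self (by exact_mod_cast hu)
  have hWb : ∀ y, ‖convect u u y‖ ≤ M₁ * M := fun y => by
    rw [convect_apply]
    exact (ContinuousLinearMap.le_opNorm _ _).trans (mul_le_mul (hM₁ y) (hM y) (norm_nonneg _) hM₁0)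
  -- Step 1: one integration by parts
  rw [integral_mul_divergence_convect_comp_sub hΦs hΦc hu x]
  have hDΦ : ∀ y, fderiv ℝ (fun z => ψ z * K z) (x - y) (convect u u y) =
      ψ (x - y) * fderiv ℝ K (x - y) (convect u u y) +
        K (x - y) * fderiv ℝ ψ (x - y) (convect u u y) := fun y => by
    rw [fderiv_fun_mul (hψd _) (hKd _)]
    simp only [_root_.add_apply, _root_.FunLike.coe_smul, Pi.smul_apply,
      smul_eq_mul]
  simp_rw [hDΦ]
  -- compact supports in `y`
  have hψx : HasCompactSupport fun y : EuclideanSpace ℝ (Fin 3) => ψ (x - y) :=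
    hψc.comp_homeomorph (Homeomorph.subLeft x)
  have hDψx : HasCompactSupport fun y : EuclideanSpace ℝ (Fin 3) => fderiv ℝ ψ (x - y) :=
    (hψc.fderiv (𝕜 := ℝ)).comp_homeomorph (Homeomorph.subLeft x)
  have hcs : Continuous fun y : EuclideanSpace ℝ (Fin 3) => x - y := continuous_const.sub continuous_id
  have hA_cont : Continuous fun y => ψ (x - y) * fderiv ℝ K (x - y) (convect u u y) :=
    (hψs.continuous.comp hcs).mul (((hKs1.continuous_fderiv one_ne_zero).comp hcs).clm_apply
      hW.continuous)
  have hB_cont : Continuous fun y => K (x - y) * fderiv ℝ ψ (x - y) (convect u u y) :=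
    (hKs1.continuous.comp hcs).mul (((hψs.continuous_fderiv one_ne_zero).comp hcs).clm_apply
      hW.continuous)
  have hA_int : Integrable fun y => ψ (x - y) * fderiv ℝ K (x - y) (convect u u y) :=
    hA_cont.integrable_of_hasCompactSupport hψx.mul_right
  have hB_int : Integrable fun y => K (x - y) * fderiv ℝ ψ (x - y) (convect u u y) := by
    refine hB_cont.integrable_of_hasCompactSupport ?_
    refine hDψx.mono' fun y hy => subset_tsupport _ ?_
    rw [mem_support] at hy ⊢
    intro h
    exact hy (by simp [h])
  rw [integral_add hA_int hB_int]
  -- Step 2a: the cutoff-gradient term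
  have hDψ_int : ∫ y, ‖fderiv ℝ ψ (x - y)‖ ≤ 3 * vR / s := by
    rw [integral_sub_left_eq_self (fun z => ‖fderiv ℝ ψ z‖) volume x]
    exact integral_norm_fderiv_radialCutoff_le hs hsR
  have hT₂ : |∫ y, K (x - y) * fderiv ℝ ψ (x - y) (convect u u y)| ≤
      B₂ * (M₁ * M) * (3 * vR / s) := by
    have hi : Integrable fun y => B₂ * (M₁ * M) * ‖fderiv ℝ ψ (x - y)‖ :=
      ((((hψs.continuous_fderiv one_ne_zero).comp hcs).norm).integrable_of_hasCompactSupport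
        hDψx.norm).const_mul _
    calc |∫ y, K (x - y) * fderiv ℝ ψ (x - y) (convect u u y)|
        ≤ ∫ y, |K (x - y) * fderiv ℝ ψ (x - y) (convect u u y)| := abs_integral_le_integral_abs
      _ ≤ ∫ y, B₂ * (M₁ * M) * ‖fderiv ℝ ψ (x - y)‖ := by
          refine integral_mono_of_nonneg (Eventually.of_forall fun y => abs_nonneg _) hi
            (Eventually.of_forall fun y => ?_)
          dsimp only
          rw [abs_mul]
          calc |K (x - y)| * |fderiv ℝ ψ (x - y) (convect u u y)|
              ≤ B₂ * (‖fderiv ℝ ψ (x - y)‖ * (M₁ * M)) := by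
                refine mul_le_mul ((hK0 _).trans (hB₂ _)) ?_ (abs_nonneg _) hB₂0
                rw [← Real.norm_eq_abs]
                exact (ContinuousLinearMap.le_opNorm _ _).trans
                  (mul_le_mul_of_nonneg_left (hWb y) (norm_nonneg _))
            _ = B₂ * (M₁ * M) * ‖fderiv ℝ ψ (x - y)‖ := by ring
      _ = B₂ * (M₁ * M) * ∫ y, ‖fderiv ℝ ψ (x - y)‖ := integral_const_mul _ _
      _ ≤ B₂ * (M₁ * M) * (3 * vR / s) := mul_le_mul_of_nonneg_left hDψ_int (by positivity)
  -- Step 2b: the kernel-gradient term, via the trilinear identity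
  set V : EuclideanSpace ℝ (Fin 3) → EuclideanSpace ℝ (Fin 3) :=
    fun y => ψ (x - y) • gradient K (x - y) with hVdef
  have hgradK : gradient K = (InnerProductSpace.toDual ℝ (EuclideanSpace ℝ (Fin 3))).symm ∘ fderiv ℝ K :=
    rfl
  have hgKs : ContDiff ℝ 1 (gradient K) := by
    rw [hgradK]
    exact (InnerProductSpace.toDual ℝ (EuclideanSpace ℝ (Fin 3))).symm.contDiff.comp
      (hKs.fderiv_right (m := 1) le_rfl)
  have hgKd : Differentiable ℝ (gradient K) := hgKs.differentiable one_ne_zero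
  have hVs : ContDiff ℝ 1 V := (hψs.comp (contDiff_const.sub contDiff_id)).smul
    (hgKs.comp (contDiff_const.sub contDiff_id))
  have hVc : HasCompactSupport V := hψx.smul_right
  have hAV : ∀ y, ψ (x - y) * fderiv ℝ K (x - y) (convect u u y) = ⟪convect u u y, V y⟫ := by
    intro y
    rw [hVdef, real_inner_smul_right, inner_gradient_eq_fderiv_apply]
  -- norms of `∇K` and `D∇K`
  have hgK_norm : ∀ z, ‖gradient K z‖ ≤ B₃ := fun z => by
    rw [hgradK, Function.comp_apply, LinearIsometryEquiv.norm_map]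
    exact (hK1 z).trans (hB₃ z)
  have hDgK_norm : ∀ z, ‖fderiv ℝ (gradient K) z‖ ≤ B₄ := fun z => by
    rw [hgradK, LinearIsometryEquiv.comp_fderiv]
    refine ContinuousLinearMap.opNorm_le_bound _ hB₄0 fun v => ?_
    rw [ContinuousLinearMap.comp_apply]
    calc ‖((InnerProductSpace.toDual ℝ (EuclideanSpace ℝ (Fin 3))).symm :
          ((EuclideanSpace ℝ (Fin 3)) →L[ℝ] ℝ) →L[ℝ] EuclideanSpace ℝ (Fin 3))
          (fderiv ℝ (fderiv ℝ K) z v)‖ = ‖fderiv ℝ (fderiv ℝ K) z v‖ :=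
          (InnerProductSpace.toDual ℝ (EuclideanSpace ℝ (Fin 3))).symm.norm_map _
      _ ≤ ‖fderiv ℝ (fderiv ℝ K) z‖ * ‖v‖ := ContinuousLinearMap.le_opNorm _ _
      _ ≤ B₄ * ‖v‖ := mul_le_mul_of_nonneg_right ((hK2 z).trans (hB₄ z)) (norm_nonneg _)
  have hDV : ∀ y, ‖fderiv ℝ V y‖ ≤ B₄ * |ψ (x - y)| + B₃ * ‖fderiv ℝ ψ (x - y)‖ := by
    intro y
    have hcd : DifferentiableAt ℝ (fun w => ψ (x - w)) y := (hψd _).comp y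
      ((differentiableAt_const x).sub differentiableAt_id)
    have hgd : DifferentiableAt ℝ (fun w => gradient K (x - w)) y := (hgKd _).comp y
      ((differentiableAt_const x).sub differentiableAt_id)
    rw [hVdef, fderiv_fun_smul hcd hgd, fderiv_comp_const_sub, fderiv_comp_const_sub]
    calc ‖ψ (x - y) • -fderiv ℝ (gradient K) (x - y) +
          (-fderiv ℝ ψ (x - y)).smulRight (gradient K (x - y))‖
        ≤ ‖ψ (x - y) • -fderiv ℝ (gradient K) (x - y)‖ +
          ‖(-fderiv ℝ ψ (x - y)).smulRight (gradient K (x - y))‖ := norm_add_le _ _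
      _ = |ψ (x - y)| * ‖fderiv ℝ (gradient K) (x - y)‖ +
          ‖fderiv ℝ ψ (x - y)‖ * ‖gradient K (x - y)‖ := by
          rw [norm_smul, norm_neg, ContinuousLinearMap.norm_smulRight_apply, norm_neg,
            Real.norm_eq_abs]
      _ ≤ |ψ (x - y)| * B₄ + ‖fderiv ℝ ψ (x - y)‖ * B₃ :=
          add_le_add (mul_le_mul_of_nonneg_left (hDgK_norm _) (abs_nonneg _))
            (mul_le_mul_of_nonneg_left (hgK_norm _) (norm_nonneg _))
      _ = _ := by ring
  have hψabs_int : ∫ y, |ψ (x - y)| ≤ vR := by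
    rw [integral_sub_left_eq_self (fun z => |ψ z|) volume x]
    exact integral_abs_radialCutoff_le hs.le hsR
  have hT₁ : |∫ y, ψ (x - y) * fderiv ℝ K (x - y) (convect u u y)| ≤
      M ^ 2 * (B₄ * vR + B₃ * (3 * vR / s)) := by
    rw [integral_congr_ae (Eventually.of_forall hAV)]
    refine (abs_integral_inner_convect_self_le hu1 hdiv hVs hVc hM).trans
      (mul_le_mul_of_nonneg_left ?_ (sq_nonneg _))
    have i1 : Integrable fun y => B₄ * |ψ (x - y)| :=
      (((hψs.continuous.comp hcs).abs).integrable_of_hasCompactSupport hψx.abs).const_mul _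
    have i2 : Integrable fun y => B₃ * ‖fderiv ℝ ψ (x - y)‖ :=
      ((((hψs.continuous_fderiv one_ne_zero).comp hcs).norm).integrable_of_hasCompactSupport
        hDψx.norm).const_mul _
    calc ∫ y, ‖fderiv ℝ V y‖ ≤ ∫ y, (B₄ * |ψ (x - y)| + B₃ * ‖fderiv ℝ ψ (x - y)‖) :=
          integral_mono_of_nonneg (Eventually.of_forall fun y => norm_nonneg _) (i1.add i2)
            (Eventually.of_forall hDV)
      _ = (B₄ * ∫ y, |ψ (x - y)|) + B₃ * ∫ y, ‖fderiv ℝ ψ (x - y)‖ := by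
          rw [integral_add i1 i2, integral_const_mul, integral_const_mul]
      _ ≤ B₄ * vR + B₃ * (3 * vR / s) :=
          add_le_add (mul_le_mul_of_nonneg_left hψabs_int hB₄0)
            (mul_le_mul_of_nonneg_left hDψ_int hB₃0)
  -- assemble
  calc |(∫ y, ψ (x - y) * fderiv ℝ K (x - y) (convect u u y)) +
        ∫ y, K (x - y) * fderiv ℝ ψ (x - y) (convect u u y)|
      ≤ |∫ y, ψ (x - y) * fderiv ℝ K (x - y) (convect u u y)| +
        |∫ y, K (x - y) * fderiv ℝ ψ (x - y) (convect u u y)| := abs_add_le _ _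
    _ ≤ M ^ 2 * (B₄ * vR + B₃ * (3 * vR / s)) + B₂ * (M₁ * M) * (3 * vR / s) := add_le_add hT₁ hT₂
    _ = _ := by ring

end Shell

/-! ## Registered sub-goal of the stub -/

/-- **Registered sub-goal** (file II of stub `stub_payerTomography`): the trilinear identity for a
divergence-free field, `∫ ⟪(u·∇)u, V⟫ = −∫ ⟪u, DV(u)⟫` (`u ∈ C¹`, `div u = 0`, `V ∈ C¹_c`), the
second integration by parts of the far-shell bound (Leray 1934, §6 (1.11)). [folklore] -/
theorem payerTomography_trilinear_divFree : ∀ (u V : EuclideanSpace ℝ (Fin 3) → EuclideanSpace ℝ (Fin 3)), ContDiff ℝ 1 u → VectorCalculus.IsDivFree u → ContDiff ℝ 1 V → HasCompactSupport V → ∫ y, inner ℝ (convect u u y) (V y) = -∫ y, inner ℝ (u y) (fderiv ℝ V y (u y)) :=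
  fun _ _ hu hdiv hV hVc => integral_inner_convect_self_eq_neg hu hdiv hV hVc

end Summit.NavierStokesRegularity.NavierStokesRegularity.Theorems

end
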